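import Summits.KontsevichZagierPeriods.KontsevichZagierPeriods.Theorems.AbelContractionRealHyperellipticSectorStubEngine

/-!
# Route AbelContraction — `HyperellipticMContraction` (crux stmt-KontsevichZagierPeriods-12474) and
# `GenusTwoContraction` (crux stmt-KontsevichZagierPeriods-12473) from the engine

Candidate closing file (written by the lead seat c2 of the programme crux `RealHyperellipticSector`
and attached as evidence on the two engine items, which that seat does not hold): both route
declarations are LITERAL special cases of the landed
`stub_engine` (`Theorems/AbelContractionRealHyperellipticSectorStubEngine.lean`: every real Cauchy
relator `Σ_j (−1)^j [O_j, P/√q]` of an M-polynomial `q ∈ ℚ[X]` lies in `KZ.relationsLE 1`) with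
`q = −∏_i (X − a_i)(X − b_i)` (rational interlaced `a_0 < b_0 < a_1 < ⋯ < b_g`, degree `2g + 2`,
leading coefficient `−1`, roots `e (2i) = a_i`, `e (2i+1) = b_i`) and `P = X^k`, `k < g`.

References: M. Kontsevich, D. Zagier, *Periods* (2001), §1.2 [KontsevichZagier2001];
B. Gross, J. Harris, *Real algebraic curves* (1981), §3 [GrossHarris1981].
-/

noncomputable section

open Set Finset
open scoped Polynomial
open Literature.NumberTheory.Transcendental Literature.NumberTheory.Transcendental.KZ
open Summit.KontsevichZagierPeriods.AbelContraction.RealHyperellipticSector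

namespace Summit.KontsevichZagierPeriods.AbelContraction.HyperellipticMContraction

/-- The interlaced branch points `a_0 < b_0 < a_1 < b_1 < ⋯ < a_g < b_g` as ONE strictly increasing
sequence `e : ℕ → ℝ` (`e (2i) = a_i`, `e (2i+1) = b_i` for `i ≤ g`, continued linearly beyond).
[folklore] -/
theorem exists_strictMono_enum (g : ℕ) (a b : Fin (g + 1) → ℚ) (hab : ∀ j, a j < b j)
    (hba : ∀ i j, i < j → b i < a j) :
    ∃ e : ℕ → ℝ, StrictMono e ∧ (∀ j : Fin (g + 1), e (2 * (j : ℕ)) = (a j : ℝ)) ∧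
      ∀ j : Fin (g + 1), e (2 * (j : ℕ) + 1) = (b j : ℝ) := by
  -- the enumeration on `ℕ`
  let f : ℕ → ℝ := fun m =>
    if hm : m < 2 * g + 2 then
      (if m % 2 = 0 then (a ⟨m / 2, by omega⟩ : ℝ) else (b ⟨m / 2, by omega⟩ : ℝ))
    else (b ⟨g, by omega⟩ : ℝ) + ((m : ℝ) - (2 * g + 1))
  have hfa : ∀ j : Fin (g + 1), f (2 * (j : ℕ)) = (a j : ℝ) := fun j => by
    have hj := j.isLt
    simp only [f, dif_pos (show 2 * (j : ℕ) < 2 * g + 2 by omega), Nat.mul_mod_right, if_true]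
    congr 2
    exact Fin.ext (by simp)
  have hfb : ∀ j : Fin (g + 1), f (2 * (j : ℕ) + 1) = (b j : ℝ) := fun j => by
    have hj := j.isLt
    simp only [f, dif_pos (show 2 * (j : ℕ) + 1 < 2 * g + 2 by omega), Nat.mul_add_mod,
      Nat.one_mod, one_ne_zero, if_false]
    congr 2
    exact Fin.ext (by simp [Nat.mul_add_div])
  refine ⟨f, strictMono_nat_of_lt_succ fun m => ?_, hfa, hfb⟩
  rcases Nat.lt_or_ge (m + 1) (2 * g + 2) with hm | hm
  · -- inside the configuration
    obtain ⟨i, rfl | rfl⟩ := Nat.even_or_odd' m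
    · -- `e (2i) = a_i < b_i = e (2i+1)`
      have hi : i < g + 1 := by omega
      have h1 := hfa ⟨i, hi⟩
      have h2 := hfb ⟨i, hi⟩
      simp only at h1 h2
      rw [h1, h2]
      exact_mod_cast hab ⟨i, hi⟩
    · -- `e (2i+1) = b_i < a_{i+1} = e (2i+2)`
      have hi : i + 1 < g + 1 := by omega
      have h1 := hfb ⟨i, by omega⟩
      have h2 := hfa ⟨i + 1, hi⟩
      simp only at h1 h2
      rw [show 2 * i + 1 + 1 = 2 * (i + 1) by ring, h1, h2]
      exact_mod_cast hba ⟨i, by omega⟩ ⟨i + 1, hi⟩ (by simp)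
  · rcases Nat.lt_or_ge m (2 * g + 2) with hm' | hm'
    · -- `m = 2g + 1`: `e m = b_g < b_g + 1`
      have hmeq : m = 2 * g + 1 := by omega
      subst hmeq
      have h1 := hfb ⟨g, by omega⟩
      simp only at h1
      rw [h1]
      simp only [f, dif_neg (show ¬ (2 * g + 1 + 1 < 2 * g + 2) by omega)]
      push_cast
      linarith
    · simp only [f, dif_neg (show ¬ (m < 2 * g + 2) by omega),
        dif_neg (show ¬ (m + 1 < 2 * g + 2) by omega)]
      push_cast
      linarith

/-- **`HyperellipticMContraction` from the engine** (crux stmt-KontsevichZagierPeriods-12474):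
for `g ≥ 1`, rationals `a_0 < b_0 < ⋯ < a_g < b_g`, `Q = ∏ (x − a_i)(x − b_i)` and `k < g`, the
alternating sum `Σ_j (−1)^j [(a_j, b_j), x^k/√(−Q)]` lies in `KZ.relationsLE 1`: it is the real
Cauchy relator of the M-polynomial `q = −Q ∈ ℚ[X]` (degree `2g+2`, leading coefficient `−1`,
roots the `a_i, b_i`) with `P = X^k`, hence covered by `stub_engine` (separating pencil).
[cite: KontsevichZagier2001, §1.2 rules (1)-(2)] [cite: GrossHarris1981, §3] -/
theorem hyperellipticMContraction_of_engine
    (hE : ∀ (q : Polynomial ℚ), cauchyRel q ⊆ (KZ.relationsLE 1 : Set KZ.FormalRep)) :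
    Summit.KontsevichZagierPeriods.KontsevichZagierPeriods.Theses.AbelContraction.HyperellipticMContraction := by
  intro g k hk a b hab hba r hdom hint
  obtain ⟨e, he, hea, heb⟩ := exists_strictMono_enum g a b hab hba
  -- the M-polynomial `q = −∏ (X − a_i)(X − b_i)` and `P = X^k`
  set Q : ℚ[X] := ∏ i : Fin (g + 1), ((Polynomial.X - Polynomial.C (a i)) *
    (Polynomial.X - Polynomial.C (b i))) with hQ_def
  set q : ℚ[X] := -Q with hq_def
  have hQmonic : Q.Monic := by
    rw [hQ_def]
    exact Polynomial.monic_prod_of_monic _ _ fun i _ =>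
      (Polynomial.monic_X_sub_C _).mul (Polynomial.monic_X_sub_C _)
  have hQdeg : Q.natDegree = 2 * g + 2 := by
    rw [hQ_def, Polynomial.natDegree_prod_of_monic _ _ fun i _ =>
      (Polynomial.monic_X_sub_C _).mul (Polynomial.monic_X_sub_C _)]
    simp only [Polynomial.natDegree_mul (Polynomial.X_sub_C_ne_zero _) (Polynomial.X_sub_C_ne_zero _),
      Polynomial.natDegree_X_sub_C, sum_const, card_univ, Fintype.card_fin, smul_eq_mul]
    ring
  have hqdeg : q.natDegree = 2 * g + 2 := by rw [hq_def, Polynomial.natDegree_neg, hQdeg]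
  have hqlc : q.leadingCoeff < 0 := by
    rw [hq_def, Polynomial.leadingCoeff_neg, hQmonic.leadingCoeff]
    norm_num
  have haeval : ∀ t : ℝ, (Polynomial.aeval t q : ℝ) =
      -∏ i : Fin (g + 1), ((t - (a i : ℝ)) * (t - (b i : ℝ))) := fun t => by
    simp only [hq_def, hQ_def, map_neg, map_prod, map_mul, map_sub, Polynomial.aeval_X,
      Polynomial.aeval_C, eq_ratCast]
  -- the roots of `q` are exactly the `e i`, `i < 2g + 2`
  have hroot : ∀ t : ℝ, Polynomial.aeval t q = 0 ↔ ∃ i < 2 * g + 2, t = e i := by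
    intro t
    rw [haeval, neg_eq_zero, Finset.prod_eq_zero_iff]
    constructor
    · rintro ⟨i, -, hi⟩
      rcases mul_eq_zero.mp hi with h | h
      · exact ⟨2 * (i : ℕ), by have := i.isLt; omega, by rw [hea i]; linarith⟩
      · exact ⟨2 * (i : ℕ) + 1, by have := i.isLt; omega, by rw [heb i]; linarith⟩
    · rintro ⟨m, hm, rfl⟩
      obtain ⟨i, rfl | rfl⟩ := Nat.even_or_odd' m
      · refine ⟨⟨i, by omega⟩, mem_univ _, ?_⟩
        rw [show (2 * i : ℕ) = 2 * ((⟨i, by omega⟩ : Fin (g + 1)) : ℕ) from rfl, hea]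
        ring
      · refine ⟨⟨i, by omega⟩, mem_univ _, ?_⟩
        rw [show (2 * i + 1 : ℕ) = 2 * ((⟨i, by omega⟩ : Fin (g + 1)) : ℕ) + 1 from rfl, heb]
        ring
  -- the relator is a real Cauchy relator of `q` with `P = X^k`
  refine hE q ⟨g, e, Polynomial.X ^ k, r, hqdeg, hqlc, he, hroot, ?_, ?_, ?_, rfl⟩
  · rw [Polynomial.natDegree_X_pow]
    exact hk
  · intro j
    rw [hdom j, hea j, heb j]
  · intro j p hp
    rw [hint j hp]
    simp only [map_pow, Polynomial.aeval_X, haeval]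

/-- **`GenusTwoContraction` from the engine** (crux stmt-KontsevichZagierPeriods-12473): the
genus-two instance `[r₀] − [r₁] + [r₂] ∈ KZ.relationsLE 1` of `HyperellipticMContraction`
(`g = 2`, `k < 2`). [cite: KontsevichZagier2001, §1.2 rules (1)-(2)] [cite: GrossHarris1981, §3] -/
theorem genusTwoContraction_of_engine
    (hE : ∀ (q : Polynomial ℚ), cauchyRel q ⊆ (KZ.relationsLE 1 : Set KZ.FormalRep)) :
    Summit.KontsevichZagierPeriods.KontsevichZagierPeriods.Theses.AbelContraction.GenusTwoContraction := by
  intro a b hab hba k hk r hdom hint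
  have h := hyperellipticMContraction_of_engine hE 2 k hk a b hab hba r hdom hint
  rw [Fin.sum_univ_three] at h
  simpa [sub_eq_add_neg] using h

/-- **`HyperellipticMContraction`** (crux stmt-KontsevichZagierPeriods-12474 of route AbelContraction),
UNCONDITIONALLY: the engine `stub_engine` is landed
(`Theorems/AbelContractionRealHyperellipticSectorStubEngine.lean`, separating pencil).
[cite: KontsevichZagier2001, §1.2 rules (1)-(2)] [cite: GrossHarris1981, §3] -/
theorem HyperellipticMContraction_proof :
    Summit.KontsevichZagierPeriods.KontsevichZagierPeriods.Theses.AbelContraction.HyperellipticMContraction :=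
  hyperellipticMContraction_of_engine
    Summit.KontsevichZagierPeriods.AbelContraction.RealHyperellipticSector.stub_engine

/-- **`GenusTwoContraction`** (crux stmt-KontsevichZagierPeriods-12473 of route AbelContraction),
UNCONDITIONALLY: the engine `stub_engine` is landed. [cite: KontsevichZagier2001, §1.2 rules (1)-(2)]
[cite: GrossHarris1981, §3] -/
theorem GenusTwoContraction_proof :
    Summit.KontsevichZagierPeriods.KontsevichZagierPeriods.Theses.AbelContraction.GenusTwoContraction :=
  genusTwoContraction_of_engine
    Summit.KontsevichZagierPeriods.AbelContraction.RealHyperellipticSector.stub_engine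

end Summit.KontsevichZagierPeriods.AbelContraction.HyperellipticMContraction

end
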